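import Summits.QuantumFields.YangMills.Theorems.LuscherReductionTwistedTraceScalingToronCell
import Summits.QuantumFields.YangMills.Theorems.LuscherReductionTwistedTraceScalingToronGain
import Summits.QuantumFields.YangMills.Theorems.LuscherReductionTwistedTraceScalingCovariantCurlLipschitz
import Summits.QuantumFields.YangMills.Theorems.LuscherReductionTwistedTraceScalingGaussianTail
import Literature.LinearAlgebra.Matrix.EckartYoungMirsky
import HarnessLib

/-!
# The zero-point sum is LIPSCHITZ in the covariant curl: `|Φ_κ(D) − Φ_κ(D')| ≤ n·√(κ/2)·‖D − D'‖`, hence the valley's ZPE comparison is first order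
# (lane A of S-BASE, crux `TwistedTraceScaling` stmt-QuantumFields-20203; design note `pub/ym-fleet/ym-luscher-20007-p1/COARSE-DESIGN.md` §15 (C5))

The normal-mode normalisation of the harmonic transfer step at a point `U` is `(π/b)^{n/2}·exp(−Φ_κ(D_U))` with the ZERO-POINT SUM
`Φ_κ(D) = Σᵢ modeZPE(κ aᵢ)` over any orthonormal frame `(e, a)` diagonalising `‖D·‖²` (`…ToronFrames`; frame independent).  Since `aᵢ = σᵢ(D)²` are the squared
singular values and `modeZPE(κσ²) = ½arcosh(1 + κσ²) = arsinh(√(κ/2)·σ)` (`arcosh_one_add_two_mul_sq`, `…ToronGain`), and `arsinh` is 1-Lipschitz while singular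
values are 1-Lipschitz in the operator (Weyl–Mirsky, tree `Literature.LinearAlgebra.Matrix.abs_singularValues_sub_le`), the zero-point sum is globally Lipschitz:
* `abs_arsinh_sub_arsinh_le`, `modeZPE_mul_sq_eq_arsinh`, `abs_modeZPE_mul_sq_sub_le` (`|modeZPE(κs²) − modeZPE(κt²)| ≤ √(κ/2)|s − t|`, `s,t ≥ 0`);
* ★ `abs_sum_modeZPE_singularValues_sub_le` — `‖Tx − T'x‖ ≤ c‖x‖ ∀x ⇒ |Σ_{i<n} modeZPE(κσᵢ(T)²) − Σ_{i<n} modeZPE(κσᵢ(T')²)| ≤ n·√(κ/2)·c`;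
* `Frame.IsDiag.sum_modeZPE_eq_sum_singularValues` — every diagonalising frame computes `Σ_{i<n} modeZPE(κσᵢ²)`; ★★ `Frame.IsDiag.abs_sum_modeZPE_sub_le` — two frames at
  `T`, `T'` differ by `≤ n√(κ/2)c` in their zero-point sums (NO spectral gap, NO second order, NO soft-mode denominators);
* lattice corollaries (`n = 9L³`): ★★ `sum_modeZPE_ge_toron_of_near` — if `‖D_U v − D_{g·V_θ} v‖ ≤ c‖v‖` for all `v`, every frame at `U` has
  `Σ modeZPE(κaᵢ) ≥ 2·toronZPE L κ 0 0 + 4·toronZPE L κ 0 (2θ) − 9L³√(κ/2)c`, and with the toron gain (`toronZPE_zero_add_slope_mul_norm_le`) ★★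
  `sum_modeZPE_ge_vacuum_add_gain_of_near`: `≥ 6·toronZPE L κ 0 0 + 4·gain1Slope L κ·‖(2θ_k : AddCircle(2π/L))‖ − 9L³√(κ/2)c`; ★ `sum_modeZPE_step_sub_le` — along a
  kinetic step with link components `≤ τ ≤ 1` the zero-point sum moves by `≤ 9L³·√(κ/2)·504τ√N`.
So at the refined-onion scales `(δ, η) = (β^{−p}, β^{−q})`, `q > 4p`, a valley point `β^{p−q/2}`-close (in `D`) to a twisted flat `g·V_θ'` with `‖2θ'_k‖ ≳ δ/L³` has zero-point
sum `≥` vacuum `+ c_Lδ − O(L³β^{p−q/2})`: the twist gain wins, first order suffices.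
HONEST FRAMING: finite-dimensional Lipschitz bookkeeping for a stub lane of a child of the CONDITIONAL reduction route (femto rung R2b1); not a gap, not Clay.
-/

set_option autoImplicit false

noncomputable section

open Finset Real Module
open scoped BigOperators InnerProductSpace
open Literature.MathematicalPhysics.QuantumFieldTheory
open Literature.MathematicalPhysics.QuantumLattice

namespace Summit.QuantumFields.YangMills.Theorems.FemtoTransferGap.TwoLattice.Toron

open Summit.QuantumFields.YangMills.Theorems.FemtoTransferGap
open Summit.QuantumFields.YangMills.Theorems.FemtoTransferGap.TwoLattice
open Summit.QuantumFields.YangMills.Theorems.FemtoTransferGap.TwoLattice.Stiff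
open Summit.QuantumFields.YangMills.Theorems.FemtoTransferGap.TwoLattice.Cov

/-! ## §1 `arsinh` is 1-Lipschitz; `modeZPE(κσ²) = arsinh(√(κ/2)σ)` is `√(κ/2)`-Lipschitz in `σ ≥ 0` -/

/-- `|arsinh x − arsinh y| ≤ |x − y|` (`arsinh' = (1 + x²)^{−1/2} ≤ 1`). [folklore] -/
theorem abs_arsinh_sub_arsinh_le (x y : ℝ) : |Real.arsinh x - Real.arsinh y| ≤ |x - y| := by
  have hderiv : ∀ z ∈ (Set.univ : Set ℝ), DifferentiableAt ℝ Real.arsinh z := fun z _ => (Real.hasDerivAt_arsinh z).differentiableAt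
  have hbound : ∀ z ∈ (Set.univ : Set ℝ), ‖deriv Real.arsinh z‖ ≤ 1 := fun z _ => by
    rw [(Real.hasDerivAt_arsinh z).deriv, Real.norm_eq_abs, abs_of_pos (inv_pos.mpr (Real.sqrt_pos.mpr (by positivity)))]
    exact inv_le_one_of_one_le₀ (Real.one_le_sqrt.mpr (by nlinarith))
  have h := convex_univ.norm_image_sub_le_of_norm_deriv_le hderiv hbound (Set.mem_univ y) (Set.mem_univ x)
  rw [Real.norm_eq_abs, Real.norm_eq_abs, one_mul] at h
  exact h

/-- `modeZPE(κs²) = arsinh(√(κ/2)·s)` for `κ, s ≥ 0`. [cite: Luscher1983, §3] -/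
theorem modeZPE_mul_sq_eq_arsinh {κ : ℝ} (hκ : 0 ≤ κ) {s : ℝ} (hs : 0 ≤ s) : modeZPE (κ * s ^ 2) = Real.arsinh (Real.sqrt (κ / 2) * s) := by
  unfold modeZPE
  have hu : 0 ≤ Real.sqrt (κ / 2) * s := mul_nonneg (Real.sqrt_nonneg _) hs
  have e : κ * s ^ 2 = 2 * (Real.sqrt (κ / 2) * s) ^ 2 := by
    rw [mul_pow, Real.sq_sqrt (by positivity)]; ring
  rw [e, arcosh_one_add_two_mul_sq hu]
  ring

/-- ★ `|modeZPE(κs²) − modeZPE(κt²)| ≤ √(κ/2)·|s − t|` for `κ, s, t ≥ 0`. [folklore] -/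
theorem abs_modeZPE_mul_sq_sub_le {κ : ℝ} (hκ : 0 ≤ κ) {s t : ℝ} (hs : 0 ≤ s) (ht : 0 ≤ t) :
    |modeZPE (κ * s ^ 2) - modeZPE (κ * t ^ 2)| ≤ Real.sqrt (κ / 2) * |s - t| := by
  rw [modeZPE_mul_sq_eq_arsinh hκ hs, modeZPE_mul_sq_eq_arsinh hκ ht]
  refine (abs_arsinh_sub_arsinh_le _ _).trans (le_of_eq ?_)
  rw [← mul_sub, abs_mul, abs_of_nonneg (Real.sqrt_nonneg _)]

/-! ## §2 Spectral sums of singular values -/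

section Spectral

variable {E F : Type*} [NormedAddCommGroup E] [InnerProductSpace ℝ E] [NormedAddCommGroup F] [InnerProductSpace ℝ F]
  [FiniteDimensional ℝ E] [FiniteDimensional ℝ F]

/-- ★ **The zero-point sum is Lipschitz in the operator**: if `‖Tx − T'x‖ ≤ c‖x‖` for all `x` (`c ≥ 0`), then
`|Σ_{i<n} modeZPE(κσᵢ(T)²) − Σ_{i<n} modeZPE(κσᵢ(T')²)| ≤ n·√(κ/2)·c` (Weyl–Mirsky for singular values + `arsinh` 1-Lipschitz).
[cite: GolubVanLoan2013, §8.6.2 Cor 8.6.2] [cite: Luscher1983, §3] -/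
theorem abs_sum_modeZPE_singularValues_sub_le (T T' : E →ₗ[ℝ] F) {κ c : ℝ} (hκ : 0 ≤ κ) (hc0 : 0 ≤ c) (hc : ∀ x, ‖T x - T' x‖ ≤ c * ‖x‖) (n : ℕ) :
    |∑ i : Fin n, modeZPE (κ * T.singularValues i ^ 2) - ∑ i : Fin n, modeZPE (κ * T'.singularValues i ^ 2)| ≤ n * (Real.sqrt (κ / 2) * c) := by
  rw [← Finset.sum_sub_distrib]
  refine (Finset.abs_sum_le_sum_abs _ _).trans ?_
  calc ∑ i : Fin n, |modeZPE (κ * T.singularValues i ^ 2) - modeZPE (κ * T'.singularValues i ^ 2)|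
      ≤ ∑ _i : Fin n, Real.sqrt (κ / 2) * c := Finset.sum_le_sum fun i _ =>
        (abs_modeZPE_mul_sq_sub_le hκ (T.singularValues_nonneg i) (T'.singularValues_nonneg i)).trans
          (mul_le_mul_of_nonneg_left (Literature.LinearAlgebra.Matrix.abs_singularValues_sub_le T T' hc0 hc i) (Real.sqrt_nonneg _))
    _ = n * (Real.sqrt (κ / 2) * c) := by rw [sum_const, card_univ, Fintype.card_fin, nsmul_eq_mul]

variable {ι ι' : Type*} [Fintype ι] [DecidableEq ι] [Fintype ι'] [DecidableEq ι']

/-- ★ **Every diagonalising frame computes the singular-value sum**: `IsDiag T e a ⇒ Σᵢ modeZPE(κaᵢ) = Σ_{i<n} modeZPE(κσᵢ(T)²)` (`n = dim E`).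
[cite: HornJohnson2013, Thm 2.5.4] -/
theorem Frame.IsDiag.sum_modeZPE_eq_sum_singularValues {T : E →ₗ[ℝ] F} {e : OrthonormalBasis ι ℝ E} {a : ι → ℝ} (h : Frame.IsDiag T e a)
    {n : ℕ} (hn : finrank ℝ E = n) (κ : ℝ) :
    ∑ i, modeZPE (κ * a i) = ∑ i : Fin n, modeZPE (κ * T.singularValues i ^ 2) := by
  rw [h.sum_eq_sum (Frame.isDiag_eigenvectorBasis T hn) (fun y => modeZPE (κ * y))]
  refine Finset.sum_congr rfl fun i _ => ?_
  rw [T.sq_singularValues_fin hn i]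

/-- ★★ **Two frames at two operators**: if `(e, a)` diagonalises `‖T·‖²`, `(e', a')` diagonalises `‖T'·‖²` and `‖Tx − T'x‖ ≤ c‖x‖` for all `x`, then
`|Σᵢ modeZPE(κaᵢ) − Σⱼ modeZPE(κa'ⱼ)| ≤ n·√(κ/2)·c` — first-order, gap-free. [cite: GolubVanLoan2013, §8.6.2 Cor 8.6.2] [cite: Luscher1983, §3] -/
theorem Frame.IsDiag.abs_sum_modeZPE_sub_le {T T' : E →ₗ[ℝ] F} {e : OrthonormalBasis ι ℝ E} {a : ι → ℝ} {e' : OrthonormalBasis ι' ℝ E} {a' : ι' → ℝ}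
    (h : Frame.IsDiag T e a) (h' : Frame.IsDiag T' e' a') {n : ℕ} (hn : finrank ℝ E = n) {κ c : ℝ} (hκ : 0 ≤ κ) (hc0 : 0 ≤ c)
    (hc : ∀ x, ‖T x - T' x‖ ≤ c * ‖x‖) :
    |∑ i, modeZPE (κ * a i) - ∑ j, modeZPE (κ * a' j)| ≤ n * (Real.sqrt (κ / 2) * c) := by
  rw [h.sum_modeZPE_eq_sum_singularValues hn κ, h'.sum_modeZPE_eq_sum_singularValues hn κ]
  exact abs_sum_modeZPE_singularValues_sub_le T T' hκ hc0 hc n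

end Spectral

/-! ## §3 Lattice corollaries: the valley's zero-point comparison is first order -/

variable (L : ℕ) [NeZero L]

/-- ★★ **Zero-point sum near a twisted flat background.**  If `‖D_U v − D_{g·V_θ} v‖ ≤ c‖v‖` for all `v` (`c ≥ 0`, `κ ≥ 0`), then EVERY orthonormal frame `(e, a)`
diagonalising `‖D_U·‖²` has `Σᵢ modeZPE(κaᵢ) ≥ 2·toronZPE L κ 0 0 + 4·toronZPE L κ 0 (2θ) − (3|E|)·√(κ/2)·c`. [cite: Luscher1983, §3] -/
theorem sum_modeZPE_ge_toron_of_near {ι : Type*} [Fintype ι] [DecidableEq ι] {U : GaugeConfig 3 L SU2} (g : Site 3 L → SU2) (θ : Fin 3 → ℝ)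
    {e : OrthonormalBasis ι ℝ (LinkSpace L)} {a : ι → ℝ} (h : Frame.IsDiag (covCurl U) e a) {κ c : ℝ} (hκ : 0 ≤ κ) (hc0 : 0 ≤ c)
    (hc : ∀ v, ‖covCurl U v - covCurl (gaugeTransform g (abelianCfg L θ)) v‖ ≤ c * ‖v‖) :
    2 * toronZPE L κ 0 0 + 4 * toronZPE L κ 0 (fun k => 2 * θ k) - (Fintype.card (Edge 3 L) * 3 : ℕ) * (Real.sqrt (κ / 2) * c) ≤
      ∑ i, modeZPE (κ * a i) := by
  classical
  have hn := finrank_linkSpace L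
  have h' := Frame.isDiag_eigenvectorBasis (covCurl (gaugeTransform g (abelianCfg L θ))) hn
  have hval := sum_modeZPE_of_isDiag_covCurl_gaugeTransform_abelianCfg L g θ h' κ
  have hdiff := Frame.IsDiag.abs_sum_modeZPE_sub_le h h' hn hκ hc0 hc
  rw [hval] at hdiff
  have := (abs_le.mp hdiff).1
  linarith

/-- ★★ **… hence at least the vacuum value plus the toron gain**: under the same hypotheses (`κ > 0`), for every direction `k`,
`Σᵢ modeZPE(κaᵢ) ≥ 6·toronZPE L κ 0 0 + 4·gain1Slope L κ·‖(2θ_k : AddCircle(2π/L))‖ − (3|E|)·√(κ/2)·c`. [cite: Luscher1983, §3] -/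
theorem sum_modeZPE_ge_vacuum_add_gain_of_near {ι : Type*} [Fintype ι] [DecidableEq ι] {U : GaugeConfig 3 L SU2} (g : Site 3 L → SU2) (θ : Fin 3 → ℝ)
    {e : OrthonormalBasis ι ℝ (LinkSpace L)} {a : ι → ℝ} (h : Frame.IsDiag (covCurl U) e a) {κ c : ℝ} (hκ : 0 < κ) (hc0 : 0 ≤ c)
    (hc : ∀ v, ‖covCurl U v - covCurl (gaugeTransform g (abelianCfg L θ)) v‖ ≤ c * ‖v‖) (k : Fin 3) :
    6 * toronZPE L κ 0 0 + 4 * (gain1Slope L κ * ‖((2 * θ k : ℝ) : AddCircle (2 * Real.pi / L))‖) -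
        (Fintype.card (Edge 3 L) * 3 : ℕ) * (Real.sqrt (κ / 2) * c) ≤ ∑ i, modeZPE (κ * a i) := by
  have h1 := sum_modeZPE_ge_toron_of_near L g θ h hκ.le hc0 hc
  have h2 : toronZPE L κ 0 0 + gain1Slope L κ * ‖((2 * θ k : ℝ) : AddCircle (2 * Real.pi / L))‖ ≤ toronZPE L κ 0 (fun k => 2 * θ k) :=
    toronZPE_zero_add_slope_mul_norm_le L hκ (fun k => 2 * θ k) k
  linarith

/-- ★ **Along a kinetic step the zero-point sum moves by `O(τ)`**: if `|vecPart(W_e)_c| ≤ τ ≤ 1` on every link, frames at `U` and at `W·U` differ in their zero-point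
sums by at most `(3|E|)·√(κ/2)·504τ√N` (`N = 3|P|`; lane B's `norm_covCurl_step_sub_le`). [cite: Luscher1983, §3] -/
theorem sum_modeZPE_step_sub_le {ι ι' : Type*} [Fintype ι] [DecidableEq ι] [Fintype ι'] [DecidableEq ι'] {W U : GaugeConfig 3 L SU2} {τ : ℝ} (hτ1 : τ ≤ 1)
    (hw : ∀ (e : Edge 3 L) (c : Fin 3), |vecPart (W e) c| ≤ τ) {e : OrthonormalBasis ι ℝ (LinkSpace L)} {a : ι → ℝ} (h : Frame.IsDiag (covCurl (W * U)) e a)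
    {e' : OrthonormalBasis ι' ℝ (LinkSpace L)} {a' : ι' → ℝ} (h' : Frame.IsDiag (covCurl U) e' a') {κ : ℝ} (hκ : 0 ≤ κ) :
    |∑ i, modeZPE (κ * a i) - ∑ j, modeZPE (κ * a' j)| ≤
      (Fintype.card (Edge 3 L) * 3 : ℕ) * (Real.sqrt (κ / 2) * (504 * τ * Real.sqrt (Fintype.card (Plaquette 3 L × Fin 3)))) := by
  have hτ0 : 0 ≤ τ := (abs_nonneg _).trans (hw default 0)
  exact Frame.IsDiag.abs_sum_modeZPE_sub_le h h' (finrank_linkSpace L) hκ (by positivity) fun v => norm_covCurl_step_sub_le U hτ1 hw v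

end Summit.QuantumFields.YangMills.Theorems.FemtoTransferGap.TwoLattice.Toron

end
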